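import Summits.QuantumAdvantage.QuantumAdvantage.Theorems.LengthDialF
import Summits.QuantumAdvantage.QuantumAdvantage.Theses.AbsorptionDial

/-!
# LengthDial, part G/7 (the route-facing theorems BY NAME: `AbsorptionDial.MassHiQuasi` (28401) ⟺ `MassHiQuasiOff` ⟺ `MassHiQuasiOne`, `closes` / `closes_off`; the split `closes_split : LawPiece → SeedPiece → MassHiQuasi` and `seedPiece_of_massHiQuasi`; X = `NoPerfectPolyOdd` (28487) ⟺ `NoPerfectOff` ⟺ `NoPerfectOne`; the aside T = `WalkPolyLossOdd` (26767) ⟺ `WalkPolyLossOff`) — support for item stmt-QuantumAdvantage-28401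

Cell decomp-qadv, seat lens-5 («finite range + asymptotic regime + bridge»), generation 26 — land port of the node
«LengthDial» (published under the cell's HOME/decomp-qadv-lens-5/g26/LengthDial.lean, record NODE-g26.md; RESIDUAL MODE on
AbsorptionDial:28401 `MassHiQuasi`).  The node file with ONLY the namespace renamed `Theses.LengthDial → Theorems.LengthDial`
and split at section boundaries into parts A–G (each importing the previous; part G alone imports the route file
Theses.AbsorptionDial for the BY-NAME equivalences and `closes`).  Prop-defs = the node's hardness predicates / grades only.
Tree facts reused by name, not restated: `RigidityLaws.walkExp_zero/self`, `RigidityLaws.ringWinU_congr_mod`,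
`RigidityLaws.threeCharge`, `RigidityLaws.hasDegF_xor`, `FibreDial.const_of_hasDegF_zero`, `WalkCoreBasics.ringWinU_compl`, `chargeRecursion`, `sliceAt_mem_lowDeg`,
`Smolensky.comp_mem_lowDeg_of_coord`.  No `sorry`, no new axioms, no instances, no notation.
-/

set_option autoImplicit false
set_option linter.unusedVariables false
set_option linter.dupNamespace false
set_option linter.style.longLine false

namespace Summit.QuantumAdvantage.QuantumAdvantage.Theorems.LengthDial

open Finset
open Summit.QuantumAdvantage.AdviceFreeQNC0
open Literature.Computability.MetaComplexity Literature.Computability.MetaComplexity.Smolensky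

section RouteFacing

/-- readback: item 28401 is literally `QuarterFloor → QuasiLoss` (`Iff.rfl`). -/
theorem massHiQuasi_unfold : Summit.QuantumAdvantage.QuantumAdvantage.Theses.AbsorptionDial.MassHiQuasi ↔ (QuarterFloor → QuasiLoss) := Iff.rfl

/-- **EQUIV**: the residual 28401 is equivalent to its off-diagonal third. -/
theorem massHiQuasi_iff_off : Summit.QuantumAdvantage.QuantumAdvantage.Theses.AbsorptionDial.MassHiQuasi ↔ MassHiQuasiOff :=
  ⟨fun h hF => quasiLossOff_of_quasiLoss (h hF), fun h hF => quasiLoss_of_off (h hF)⟩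

/-- from the OFF-DIAGONAL piece, BY NAME onto the residual item 28401 of route Summit.QuantumAdvantage.QuantumAdvantage.Theses.AbsorptionDial. -/
theorem closes_off (h : MassHiQuasiOff) : Summit.QuantumAdvantage.QuantumAdvantage.Theses.AbsorptionDial.MassHiQuasi :=
  massHiQuasi_iff_off.2 h

/-- **X ⟺ X_off** (the pointwise peel identities; no counting). -/
theorem noPerfectPolyOdd_iff_off : Summit.QuantumAdvantage.QuantumAdvantage.Theses.AbsorptionDial.NoPerfectPolyOdd ↔ NoPerfectOff := by
  constructor
  · intro h p _ hp C
    obtain ⟨n₀, hn₀⟩ := h p hp C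
    exact ⟨n₀, fun n hn c _ y hy => hn₀ n hn c y hy⟩
  · intro h p _ hp C
    obtain ⟨n₀, hn₀⟩ := h p hp (2 * C + 3)
    refine ⟨n₀ + 6, fun n hn c y hy => ?_⟩
    obtain ⟨k, rfl⟩ : ∃ k, n = k + 2 := ⟨n - 2, by omega⟩
    have hk4 : 4 ≤ k := by omega
    have hdeg : 5 * Nat.log 2 (k + 2) ^ C ≤ Nat.log 2 k ^ (2 * C + 3) := log_ineq C k hk4
    have hdeg1 : 5 * Nat.log 2 (k + 2) ^ C ≤ Nat.log 2 (k + 1) ^ (2 * C + 3) :=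
      hdeg.trans (Nat.pow_le_pow_left (Nat.log_mono_right (by omega)) _)
    by_contra hall
    push Not at hall
    have hwin : ∀ u, ringWinU c y u = true := fun u => by
      have := hall u
      cases hu : ringWinU c y u
      · exact absurd hu this
      · rfl
    by_cases hgood : c1 c true % 3 ≠ (k + 1) % 3
    · obtain ⟨u', hu'⟩ := hn₀ (k + 1) (by omega) (c1 c true) hgood (peel1 c true y)
        fun g => hasDegF_mono (hasDegF_peel1 c true hy g) hdeg1
      rw [← ringWinU_peel1 c true y hgood, hwin] at hu'
      exact Bool.noConfusion hu'
    · push Not at hgood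
      obtain ⟨u'', hu''⟩ := hn₀ k (by omega) (c2 c true true) (c2_offDiag c k true true hgood)
        (peel2 c true true y) fun g => hasDegF_mono (hasDegF_peel2 c true true hy g) hdeg
      rw [← ringWinU_peel2 c true true y hgood, hwin] at hu''
      exact Bool.noConfusion hu''

/-- **T ⟺ T_off**. -/
theorem walkPolyLossOdd_iff_off : Summit.QuantumAdvantage.QuantumAdvantage.Theses.AbsorptionDial.WalkPolyLossOdd ↔ WalkPolyLossOff := by
  constructor
  · intro h p _ hp C
    obtain ⟨K, n₀, hn₀⟩ := h p hp C
    exact ⟨K, n₀, fun n hn c _ y hy => hn₀ n hn c y hy⟩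
  · intro h p _ hp C
    obtain ⟨K, n₀, hn₀⟩ := h p hp (2 * C + 3)
    refine ⟨K, n₀ + 6, fun n hn c y hy => ?_⟩
    obtain ⟨k, rfl⟩ : ∃ k, n = k + 2 := ⟨n - 2, by omega⟩
    have hk4 : 4 ≤ k := by omega
    have hdeg : 5 * Nat.log 2 (k + 2) ^ C ≤ Nat.log 2 k ^ (2 * C + 3) := log_ineq C k hk4
    have hdeg1 : 5 * Nat.log 2 (k + 2) ^ C ≤ Nat.log 2 (k + 1) ^ (2 * C + 3) :=
      hdeg.trans (Nat.pow_le_pow_left (Nat.log_mono_right (by omega)) _)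
    have h1 : OffHardR p (k + 1) (5 * Nat.log 2 (k + 2) ^ C) (1 - 1 / ((k + 1 : ℕ) : ℝ) ^ K) := by
      intro c' hc' y' hy'
      have := hn₀ (k + 1) (by omega) c' hc' y' fun g => hasDegF_mono (hy' g) hdeg1
      simpa [winCount] using this
    have h0 : OffHardR p k (5 * Nat.log 2 (k + 2) ^ C) (1 - 1 / ((k : ℕ) : ℝ) ^ K) := by
      intro c' hc' y' hy'
      have := hn₀ k (by omega) c' hc' y' fun g => hasDegF_mono (hy' g) hdeg
      simpa [winCount] using this
    have hlaw := lengthLaw h1 h0 c y hy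
    have hθ : max (1 - 1 / ((k : ℕ) : ℝ) ^ K) (1 - 1 / ((k + 1 : ℕ) : ℝ) ^ K)
        ≤ 1 - 1 / ((k + 2 : ℕ) : ℝ) ^ K :=
      max_le (theta_poly_mono K (by omega) (by omega)) (theta_poly_mono K (by omega) (by omega))
    have := hlaw.trans (mul_le_mul_of_nonneg_right hθ (by positivity))
    simpa [winCount] using this

/-- **EQUIV (sharp)**: the residual 28401 is equivalent to its ONE-CLASS form. -/
theorem massHiQuasi_iff_one : Summit.QuantumAdvantage.QuantumAdvantage.Theses.AbsorptionDial.MassHiQuasi ↔ MassHiQuasiOne :=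
  ⟨fun h hF => quasiLoss_iff_one.1 (h hF), fun h hF => quasiLoss_iff_one.2 (h hF)⟩

/-- `closes`, BY NAME onto the residual item 28401 of route AbsorptionDial, from the SHARP piece. -/
theorem closes (h : MassHiQuasiOne) : Summit.QuantumAdvantage.QuantumAdvantage.Theses.AbsorptionDial.MassHiQuasi :=
  massHiQuasi_iff_one.2 h

/-- **X ⟺ X_one**: item 28487 is decided on the single class `c ≡ n+1 (mod 3)`. -/
theorem noPerfectPolyOdd_iff_one : Summit.QuantumAdvantage.QuantumAdvantage.Theses.AbsorptionDial.NoPerfectPolyOdd ↔ NoPerfectOne :=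
  noPerfectPolyOdd_iff_off.trans noPerfectOff_iff_one

/-- 28401 ⟹ the seed piece. -/
theorem seedPiece_of_massHiQuasi (h : Summit.QuantumAdvantage.QuantumAdvantage.Theses.AbsorptionDial.MassHiQuasi) : SeedPiece :=
  fun hF => seeds_of_quasiLossOff (quasiLossOff_of_quasiLoss (h hF))

/-- `closes_split`: LAW PIECE → SEED PIECE → the residual 28401, BY NAME. -/
theorem closes_split (hL : LawPiece) (hS : SeedPiece) : Summit.QuantumAdvantage.QuantumAdvantage.Theses.AbsorptionDial.MassHiQuasi :=
  fun hF => quasiLoss_of_lawPiece_seeds hL (hS hF)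

end RouteFacing

end Summit.QuantumAdvantage.QuantumAdvantage.Theorems.LengthDial
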